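/-
Copyright (c) 2026 the pub-hodgecm-mathlib formalisation cell (harness21).  Prover seat hodgecm-mathlib-K2E1-p08 (g3), Track B ∕ K2-LIT
(build stream 29), h413 = `stmt-HodgeConjecture-24833`, line `K2_E1_TraceFormulaBeta`, row 10 (DEAL F ∕ G1 rung b: the twist `ε_v` and the integral levels);
dealer K2E1-plan (g2) RULING «G1 GO» 2026-09-04T01:27:06Z.  2026-09-04.
-/
import Summits.HodgeConjecture.HodgeConjecture.Theorems.K2E1TwistEpsilonInvolution   -- ★ p856522 (K2E1-p08 g3) G1 rung a: functoriality ∕ involutivity of `ε` (brings ★ TwistedDefs)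
import Literature.NumberTheory.Automorphic.UnitaryGroupLocalCongr                  -- ★ `eventually_forall_map_mem_glInt` (`Φ_w ∈ GL_n(𝒪_w)` a.e.)
import Literature.NumberTheory.Automorphic.ValuedFieldValuativeRelBridge            -- ★ `mem_glInt_iff_forall_v_le_one`
import Literature.NumberTheory.Automorphic.LocalGLCongruenceBoxIwahori              -- ★ `localGLPiEquiv_apply_apply` (entries of the `w`-components)
import HarnessLib

/-!
# h413 ∕ Track B «K2-LIT», line `K2_E1_TraceFormulaBeta`, row 10 (G1 rung b) — `K2E1TwistEpsilonLevels`: the local twist `ε_v` of `G̃ = Res_{E∕F} GL_n` PRESERVES THE INTEGRAL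
# LEVEL `GL_n(Π_{w∣v} 𝒪_w)` at almost every place `v` (and entrywise `σ_v = c ⊗ 1`, `g ↦ (gᵀ)⁻¹` preserve it at EVERY place)

Cell `pub/hodgecm-mathlib`, crux H413 = `stmt-HodgeConjecture-24833`, route of record `HCCMUnconditional`; chair K2-lead (g0), dealer K2E1-plan (g2) (RULING «G1 GO»
2026-09-04T01:27:06Z, item «`K`-a.e.»: the twist maps `K_v = GL_n(Π_{w∣v} 𝒪_w)` (★ `localLevelGt E n v` of ★ `K2E1GlobalTestFunctionsTwistedDefs`) onto itself for almost all `v`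
— the input making `φ_v ∘ ε_v = 𝟙_{K_v}` a.e. for the `twist` of a twisted pure tensor ★ `GlobalTestFunctionGt`).  `ε_v(g) = Φ_v⁻¹ ((σ_v g)ᵀ)⁻¹ Φ_v` (★ `twistLocal_apply`) with
`σ_v = conjLocal E c v` acting on `E_v = Π_{w∣v} E_w` by `(σ_v x)_w = c_w(x_{c⁻¹w})` (★ `conjLocal_apply`, ★ `galAdicCompletionMap`): (i) `σ_v` permutes the places over `v` and
`c_w : E_{c⁻¹w} → E_w` preserves the valuation (★ `valued_galAdicCompletionMap`), so entrywise `σ_v` preserves `K_v` at EVERY `v`; (ii) `g ↦ (gᵀ)⁻¹` preserves `K_v` at every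
`v` (the entries of `(gᵀ)⁻¹` and its inverse are those of `g⁻¹` and `g`); (iii) `Φ_v ∈ K_v` for all but finitely many `v` (★ `eventually_forall_map_mem_glInt`: `Φ` and `Φ⁻¹` are
`w`-integral a.e.), and `K_v` is a subgroup.  THEOREMS ONLY (no `def`, no `instance`, no `notation`, no named-fact hypothesis, no `sorry`); lane `--kind proof --supports
stmt-HodgeConjecture-24833 --as helper`.

* §1 `mem_localLevelGt_iff_forall_valued` (entrywise criterion: all entries of `g` and `g⁻¹` have `v_w ≤ 1` at every `w ∣ v`).
* §2 **`map_conjLocal_mem_localLevelGt_iff`** (all `v`), **`glTransposeInv_mem_localLevelGt_iff`** (all `v`), `eventually_formLocal_mem_localLevelGt`,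
  **`eventually_twistLocal_mem_localLevelGt_iff`** (`∀ᶠ v, ∀ g, ε_v g ∈ K_v ↔ g ∈ K_v`) and its set form `eventually_preimage_twistLocal_localLevelGt`.

HONEST LABEL.  Count-neutral helper; closes no socket by itself; HC_CM is proved only modulo the 7 printed citations (2 remaining named inputs: hLiu418 =
`stmt-HodgeConjecture-24832`, h413 = `stmt-HodgeConjecture-24833`) until rung 0 closes.

## References
* [Rogawski1990] J. D. Rogawski, *Automorphic Representations of Unitary Groups in Three Variables* (1990), §4.7 p. 47, §4.10 p. 57 (unramified data: `K̃_v` ε-stable).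
* [PlatonovRapinchuk1994] V. Platonov, A. Rapinchuk, *Algebraic Groups and Number Theory* (1994), §5.1 (integral structures at almost all places).
* [CasselsFrohlichANT1967] J. W. S. Cassels, A. Fröhlich (eds.), *Algebraic Number Theory* (1967), Ch. VII §1.1.
-/

set_option autoImplicit false
-- the mandated namespace repeats `HodgeConjecture.HodgeConjecture`, as in every `Theorems/*.lean` of this sub-problem
set_option linter.dupNamespace false

noncomputable section

open NumberField IsDedekindDomain Set Filter
open scoped MatrixGroups Matrix

namespace Summit.HodgeConjecture.HodgeConjecture.Cruxes.H413.K2E1TwistEpsilonLevels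

open Literature.NumberTheory.Automorphic Literature.NumberTheory.Automorphic.UnitaryGroup
open Literature.NumberTheory.GaloisRepresentations (glTransposeInv coe_glTransposeInv_apply)
open Summit.HodgeConjecture.HodgeConjecture.Cruxes.H413.K2E1GlobalTestFunctionsTwisted

variable {F : Type} (E : Type) [Field F] [NumberField F] [Field E] [NumberField E] [Algebra F E] (n : ℕ)

/-! ## §1 The entrywise criterion for `GL_n(Π_{w∣v} 𝒪_w)` -/

omit [NumberField F] in
/-- **`g ∈ GL_n(Π_{w∣v} 𝒪_w)` iff every entry of `g` and of `g⁻¹` has `v_w ≤ 1` at every `w ∣ v`** (★ `mem_localLevelGt_iff` + ★ `mem_glInt_iff_forall_v_le_one` + ★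
`localGLPiEquiv_apply_apply`). [cite: PlatonovRapinchuk1994, §5.1] -/
theorem mem_localLevelGt_iff_forall_valued (v : HeightOneSpectrum (𝓞 F)) (g : GL (Fin n) (LocalRing E v)) :
    g ∈ localLevelGt E n v ↔
      (∀ (w : PlacesOver E v) (i j : Fin n), Valued.v (((g : GL (Fin n) (LocalRing E v)) : Matrix (Fin n) (Fin n) (LocalRing E v)) i j w) ≤ 1) ∧
        ∀ (w : PlacesOver E v) (i j : Fin n), Valued.v (((g⁻¹ : GL (Fin n) (LocalRing E v)) : Matrix (Fin n) (Fin n) (LocalRing E v)) i j w) ≤ 1 := by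
  rw [mem_localLevelGt_iff]
  have key : ∀ w : PlacesOver E v, localGLPiEquiv E n v g w ∈ glInt n (w.1.adicCompletion E) ↔
      (∀ i j : Fin n, Valued.v (((g : GL (Fin n) (LocalRing E v)) : Matrix (Fin n) (Fin n) (LocalRing E v)) i j w) ≤ 1) ∧
        ∀ i j : Fin n, Valued.v (((g⁻¹ : GL (Fin n) (LocalRing E v)) : Matrix (Fin n) (Fin n) (LocalRing E v)) i j w) ≤ 1 := by
    intro w
    have hinv : (localGLPiEquiv E n v g w)⁻¹ = localGLPiEquiv E n v g⁻¹ w := by rw [map_inv, Pi.inv_apply]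
    rw [mem_glInt_iff_forall_v_le_one, hinv]
    simp only [localGLPiEquiv_apply_apply]
  simp only [key]
  exact ⟨fun h => ⟨fun w => (h w).1, fun w => (h w).2⟩, fun h w => ⟨h.1 w, h.2 w⟩⟩

/-! ## §2 `σ_v`, `g ↦ (gᵀ)⁻¹` and `ε_v` preserve the level -/

/-- **Entrywise `σ_v = c ⊗ 1` preserves `GL_n(Π_{w∣v} 𝒪_w)` at EVERY place `v`**: `(σ_v x)_w = c_w(x_{c⁻¹w})` with `c_w` valuation-preserving (★ `valued_galAdicCompletionMap`), and
`w ↦ c⁻¹ w` permutes the places over `v`. [cite: CasselsFrohlichANT1967, Ch. VII §1.1] [cite: PlatonovRapinchuk1994, §5.1] -/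
theorem map_conjLocal_mem_localLevelGt_iff (c : E ≃ₐ[F] E) (v : HeightOneSpectrum (𝓞 F)) (g : GL (Fin n) (LocalRing E v)) :
    Matrix.GeneralLinearGroup.map (conjLocal E c v) g ∈ localLevelGt E n v ↔ g ∈ localLevelGt E n v := by
  -- the permutation `τ w = c⁻¹ w` of the places over `v`
  have hτ : Function.Surjective fun w : PlacesOver E v => (⟨c⁻¹ • w.1, under_inv_smul_eq c w⟩ : PlacesOver E v) := by
    intro w₀
    refine ⟨⟨c • w₀.1, by rw [HeightOneSpectrum.under_algEquiv_smul]; exact w₀.2⟩, Subtype.ext ?_⟩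
    change c⁻¹ • c • w₀.1 = w₀.1
    rw [inv_smul_smul]
  rw [mem_localLevelGt_iff_forall_valued, mem_localLevelGt_iff_forall_valued, ← map_inv]
  simp only [Matrix.GeneralLinearGroup.map_apply, conjLocal_apply, valued_galAdicCompletionMap]
  rw [hτ.forall (p := fun w => ∀ i j : Fin n, Valued.v (((g : GL (Fin n) (LocalRing E v)) : Matrix (Fin n) (Fin n) (LocalRing E v)) i j w) ≤ 1),
    hτ.forall (p := fun w => ∀ i j : Fin n, Valued.v (((g⁻¹ : GL (Fin n) (LocalRing E v)) : Matrix (Fin n) (Fin n) (LocalRing E v)) i j w) ≤ 1)]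

omit [NumberField F] in
/-- **`g ↦ (gᵀ)⁻¹` preserves `GL_n(Π_{w∣v} 𝒪_w)` at EVERY place `v`** (the entries of `(gᵀ)⁻¹` are those of `g⁻¹`, the entries of its inverse those of `g`).
[cite: PlatonovRapinchuk1994, §5.1] -/
theorem glTransposeInv_mem_localLevelGt_iff (v : HeightOneSpectrum (𝓞 F)) (g : GL (Fin n) (LocalRing E v)) :
    glTransposeInv (Fin n) (LocalRing E v) g ∈ localLevelGt E n v ↔ g ∈ localLevelGt E n v := by
  rw [mem_localLevelGt_iff_forall_valued, mem_localLevelGt_iff_forall_valued, ← map_inv]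
  simp only [coe_glTransposeInv_apply, inv_inv, Matrix.transpose_apply]
  exact ⟨fun h => ⟨fun w i j => h.2 w j i, fun w i j => h.1 w j i⟩, fun h => ⟨fun w i j => h.2 w j i, fun w i j => h.1 w j i⟩⟩

variable (Φ : GL (Fin n) E)

omit [NumberField F] in
/-- **`Φ ⊗ 1 ∈ GL_n(Π_{w∣v} 𝒪_w)` for all but finitely many `v`** (★ `eventually_forall_map_mem_glInt`: `Φ_w, Φ_w⁻¹` are `w`-integral a.e.; the `w`-component of ★ `formLocal` is
`Φ ⊗_E E_w`). [cite: PlatonovRapinchuk1994, §5.1] -/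
theorem eventually_formLocal_mem_localLevelGt : ∀ᶠ v : HeightOneSpectrum (𝓞 F) in cofinite, formLocal E n Φ v ∈ localLevelGt E n v := by
  filter_upwards [eventually_forall_map_mem_glInt F E Φ] with v hv
  rw [mem_localLevelGt_iff]
  intro w
  have e : localGLPiEquiv E n v (formLocal E n Φ v) w = Matrix.GeneralLinearGroup.map (algebraMap E (w.1.adicCompletion E)) Φ :=
    Units.ext (Matrix.ext fun i j => by rw [localGLPiEquiv_apply_apply]; rfl)
  rw [e]
  exact hv w

/-- **THE LOCAL TWIST PRESERVES THE INTEGRAL LEVEL AT ALMOST EVERY PLACE**: `∀ᶠ v, ∀ g, ε_v(g) ∈ GL_n(Π_{w∣v} 𝒪_w) ↔ g ∈ GL_n(Π_{w∣v} 𝒪_w)` — `ε_v g = Φ_v⁻¹ · ((σ_v g)ᵀ)⁻¹ · Φ_v`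
(★ `twistLocal_apply`) with all three operations level-preserving (this file) once `Φ_v ∈ K_v`. (Print: at the unramified places the standard hyperspecial subgroup `K̃_v` of
`G̃(F_v) = GL_n(E_v)` is ε-stable — the shape of the unit of the twisted Hecke algebra, §4.10.) [cite: Rogawski1990, §4.10 p. 57; §4.7 p. 47] [cite: PlatonovRapinchuk1994, §5.1] -/
theorem eventually_twistLocal_mem_localLevelGt_iff (c : E ≃ₐ[F] E) :
    ∀ᶠ v : HeightOneSpectrum (𝓞 F) in cofinite, ∀ g : GL (Fin n) (LocalRing E v), twistLocal E n Φ c v g ∈ localLevelGt E n v ↔ g ∈ localLevelGt E n v := by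
  filter_upwards [eventually_formLocal_mem_localLevelGt E n Φ] with v hΦv g
  rw [twistLocal_apply, inv_inv]
  constructor
  · intro h
    have e : glTransposeInv (Fin n) (LocalRing E v) (Matrix.GeneralLinearGroup.map (conjLocal E c v) g) =
        formLocal E n Φ v * ((formLocal E n Φ v)⁻¹ * glTransposeInv (Fin n) (LocalRing E v) (Matrix.GeneralLinearGroup.map (conjLocal E c v) g) * formLocal E n Φ v) *
          (formLocal E n Φ v)⁻¹ := by group
    have h1 : glTransposeInv (Fin n) (LocalRing E v) (Matrix.GeneralLinearGroup.map (conjLocal E c v) g) ∈ localLevelGt E n v := by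
      rw [e]
      exact Subgroup.mul_mem _ (Subgroup.mul_mem _ hΦv h) (Subgroup.inv_mem _ hΦv)
    exact (map_conjLocal_mem_localLevelGt_iff E n c v g).1 ((glTransposeInv_mem_localLevelGt_iff E n v _).1 h1)
  · intro h
    exact Subgroup.mul_mem _ (Subgroup.mul_mem _ (Subgroup.inv_mem _ hΦv)
      ((glTransposeInv_mem_localLevelGt_iff E n v _).2 ((map_conjLocal_mem_localLevelGt_iff E n c v g).2 h))) hΦv

/-- Set form: `∀ᶠ v, ε_v⁻¹(K_v) = K_v` (so `𝟙_{K_v} ∘ ε_v = 𝟙_{K_v}`, the unramified clause of the twist of a pure tensor). [cite: Rogawski1990, §4.10 p. 57] -/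
theorem eventually_preimage_twistLocal_localLevelGt (c : E ≃ₐ[F] E) :
    ∀ᶠ v : HeightOneSpectrum (𝓞 F) in cofinite,
      (twistLocal E n Φ c v) ⁻¹' (localLevelGt E n v : Set (GL (Fin n) (LocalRing E v))) = (localLevelGt E n v : Set (GL (Fin n) (LocalRing E v))) := by
  filter_upwards [eventually_twistLocal_mem_localLevelGt_iff E n Φ c] with v hv
  ext g
  exact hv g

end Summit.HodgeConjecture.HodgeConjecture.Cruxes.H413.K2E1TwistEpsilonLevels

end
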